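import Summits.ValiantsHypothesis.ValiantsHypothesis.Theorems.KPlusLogSqLawTropicalBMarkedEdgeCoreQHall

/-!
# Route «KPlusLogSqLaw», crux `TropicalB` (stmt-ValiantsHypothesis-19771) — MARKED-EDGE sector, NESTED-TRIANGLE CORE, ALL sizes:
# the Q-COVER THEOREM (g18's «S3*»), part B2 — the pair trichotomy «Q-cover ∨ A1-witness ∨ A2-witness»

HONEST FRAMING.  Helper file (cell `pub-symmetroid`, seat val-sym-trop-p4 (g19), 2026-08-29; `--supports stmt-ValiantsHypothesis-19771 --as
helper`).  Continues parts A (`…CoreQTrunk`) and B1 (`…CoreQHall`).  ONE pair of colours `ξ, η : Equiv.Perm V` (in the application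
`σZ⁻¹σX, σZ⁻¹σY`), gates `b0 ≠ b4`, a marked arc `b ↦ z` (`ξ b = η b = z`), Z-rigidity in cover form.  Nothing here proves the law; nothing
concerns `TropicalB` in its window, `WeakLifting`, the doors, `MatrixDescartes` (stmt-ValiantsHypothesis-18050) or VP ≠ VNP.

**THEOREM `cover_or_witness` (pair trichotomy).**  Under Z-rigidity, either a **Q-cover** exists (`ρ` inside `ξ ∪ η ∪ id`, `ρ b4 = b4`,
`ρ b = z`, `ρ b0 ≠ b0`), or an **A1-witness** (`F ⊆ V ∖ {b0,b4}`, `b ∈ F ∌ z`, pred-closed up to `b4`), or an **A2-witness**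
(`B ⊆ V ∖ {b0,b4}`, `z ∈ B ∌ b`, succ-closed up to `b4`).  Proof: reachability from `b0` / from `z` by `ξ,η`-steps avoiding the gates; if `b`
is unreachable, the unreachable set minus the separating set `C` of part B1 is an A1-witness; if `b0` is unreachable from `z`, the set reachable
from `z` is an A2-witness (`b ∉` it by the dual separating set); if both are reachable, Hall's theorem gives the Q-cover — a Hall violator `X`
would satisfy `ξ(X) = η(X) ⊇ (X ∖ {b0, b}) ∪ {b4}`, and following the two reachabilities through `X` produces a return `z ⇝ b`, excluded by
the dual separating set.  No path data structures: only `Relation.(Refl)TransGen` inductions and finset cardinalities.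
-/

set_option linter.dupNamespace false
set_option autoImplicit false

namespace Summit.ValiantsHypothesis.ValiantsHypothesis.Theorems.KPlusLogSqLaw
namespace MarkedEdge
namespace Core
namespace QCover

open Finset

variable {V : Type*} [Fintype V] [DecidableEq V]

/-! ### The pair trichotomy -/

/-- **Pair trichotomy (Q-cover ∨ A1-witness ∨ A2-witness).**  For a pair of colours `ξ, η` moving the gate `b0`, a marked arc
`b ↦ z` (`ξ b = η b = z`, with `b, z, b0, b4` distinct as stated) and Z-rigidity, one of: a Q-cover; an A1-witness `F`; an A2-witness `B`.
[this seat's theorem] -/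
theorem cover_or_witness (ξ η : Equiv.Perm V) (b0 b4 b z : V) (hξb : ξ b = z) (hηb : η b = z)
    (hξ0 : ξ b0 ≠ b0) (hη0 : η b0 ≠ b0) (h04 : b0 ≠ b4) (hbb0 : b ≠ b0) (hbb4 : b ≠ b4) (hz0 : z ≠ b0) (hz4 : z ≠ b4)
    (hbz : b ≠ z)
    (H2 : ∀ ρ : Equiv.Perm V, (∀ i, ρ i = i ∨ ρ i = ξ i ∨ ρ i = η i) → ρ b0 = b0 → ρ b4 = b4 → ρ = 1) :
    (∃ ρ : Equiv.Perm V, (∀ i, ρ i = i ∨ ρ i = ξ i ∨ ρ i = η i) ∧ ρ b4 = b4 ∧ ρ b = z ∧ ρ b0 ≠ b0)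
    ∨ (∃ F : Finset V, b ∈ F ∧ z ∉ F ∧ b0 ∉ F ∧ b4 ∉ F ∧
        (∀ u, ξ u ∈ F → u ∈ F ∨ u = b4) ∧ (∀ u, η u ∈ F → u ∈ F ∨ u = b4))
    ∨ (∃ B : Finset V, z ∈ B ∧ b ∉ B ∧ b0 ∉ B ∧ b4 ∉ B ∧
        (∀ u ∈ B, ξ u ∈ B ∨ ξ u = b4) ∧ (∀ u ∈ B, η u ∈ B ∨ η u = b4)) := by
  classical
  -- separating sets, primal and dual
  obtain ⟨C, hzC, hbC, -, -, hC⟩ := sep_of_rigid ξ η b0 b4 b z hξb hbz hbb0 hbb4 hz0 hz4 h04 H2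
  obtain ⟨D, hbD, hzD, -, -, hD⟩ := sep_of_rigid ξ⁻¹ η⁻¹ b0 b4 z b
    (by rw [Equiv.Perm.inv_eq_iff_eq, hξb]) hbz.symm hz0 hz4 hbb0 hbb4 h04 (rigid_dual ξ η b0 b4 H2)
  -- the step relation inside W
  let r : V → V → Prop := fun u v => (v = ξ u ∨ v = η u) ∧ v ≠ b0 ∧ v ≠ b4
  have hr : ∀ u v, r u v ↔ (v = ξ u ∨ v = η u) ∧ v ≠ b0 ∧ v ≠ b4 := fun u v => Iff.rfl
  by_cases hA1 : Relation.TransGen r b0 b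
  swap
  · -- ¬A1: the unreachable set minus `C` is an A1-witness
    right; left
    refine ⟨Finset.univ.filter (fun v => v ≠ b0 ∧ v ≠ b4 ∧ ¬ Relation.TransGen r b0 v ∧ v ∉ C),
      ?_, ?_, ?_, ?_, ?_, ?_⟩
    · simp [hbb0, hbb4, hA1, hbC]
    · simp [hzC]
    · simp
    · simp
    · intro u hu
      simp only [Finset.mem_filter, Finset.mem_univ, true_and] at hu
      obtain ⟨hu0, hu4, hur, huC⟩ := hu
      by_cases h4 : u = b4
      · exact Or.inr h4
      left
      simp only [Finset.mem_filter, Finset.mem_univ, true_and]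
      have hu0' : u ≠ b0 := by
        rintro rfl
        exact hur (Relation.TransGen.single ((hr _ _).mpr ⟨Or.inl rfl, hu0, hu4⟩))
      refine ⟨hu0', h4, fun h => hur (h.tail ((hr _ _).mpr ⟨Or.inl rfl, hu0, hu4⟩)), fun h => ?_⟩
      rcases (hC u h).1 with h1 | h1 | h1
      · exact huC h1
      · exact hu0 h1
      · exact hu4 h1
    · intro u hu
      simp only [Finset.mem_filter, Finset.mem_univ, true_and] at hu
      obtain ⟨hu0, hu4, hur, huC⟩ := hu
      by_cases h4 : u = b4
      · exact Or.inr h4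
      left
      simp only [Finset.mem_filter, Finset.mem_univ, true_and]
      have hu0' : u ≠ b0 := by
        rintro rfl
        exact hur (Relation.TransGen.single ((hr _ _).mpr ⟨Or.inr rfl, hu0, hu4⟩))
      refine ⟨hu0', h4, fun h => hur (h.tail ((hr _ _).mpr ⟨Or.inr rfl, hu0, hu4⟩)), fun h => ?_⟩
      rcases (hC u h).2 with h1 | h1 | h1
      · exact huC h1
      · exact hu0 h1
      · exact hu4 h1
  by_cases hA2 : ∃ v, Relation.ReflTransGen r z v ∧ (ξ v = b0 ∨ η v = b0)
  swap
  · -- ¬A2: the set reachable from `z` is an A2-witness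
    right; right
    have hW : ∀ v, Relation.ReflTransGen r z v → v ≠ b0 ∧ v ≠ b4 :=
      fun v h => reach_ne_gates ξ η b0 b4 r hr z v hz0 hz4 h
    refine ⟨Finset.univ.filter (fun v => Relation.ReflTransGen r z v), ?_, ?_, ?_, ?_, ?_, ?_⟩
    · simp [Relation.ReflTransGen.refl]
    · simp only [Finset.mem_filter, Finset.mem_univ, true_and]
      intro h
      exact hzD (reach_mem_of_predClosed ξ η b0 b4 r hr D hD z b hz0 hz4 h hbD)
    · simp only [Finset.mem_filter, Finset.mem_univ, true_and]
      intro h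
      exact (hW b0 h).1 rfl
    · simp only [Finset.mem_filter, Finset.mem_univ, true_and]
      intro h
      exact (hW b4 h).2 rfl
    · intro u hu
      simp only [Finset.mem_filter, Finset.mem_univ, true_and] at hu ⊢
      by_cases h4 : ξ u = b4
      · exact Or.inr h4
      left
      have h0 : ξ u ≠ b0 := fun h => hA2 ⟨u, hu, Or.inl h⟩
      exact hu.tail ((hr _ _).mpr ⟨Or.inl rfl, h0, h4⟩)
    · intro u hu
      simp only [Finset.mem_filter, Finset.mem_univ, true_and] at hu ⊢
      by_cases h4 : η u = b4
      · exact Or.inr h4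
      left
      have h0 : η u ≠ b0 := fun h => hA2 ⟨u, hu, Or.inr h⟩
      exact hu.tail ((hr _ _).mpr ⟨Or.inr rfl, h0, h4⟩)
  -- A1 ∧ A2: the Q-cover exists by Hall's theorem
  left
  let t : V → Finset V := fun i =>
    if i = b4 then {b4} else if i = b then {z} else if i = b0 then {ξ b0, η b0} else {i, ξ i, η i}
  have ht4 : t b4 = {b4} := by simp [t]
  have htb : t b = {z} := by simp [t, hbb4]
  have ht0 : t b0 = {ξ b0, η b0} := by simp [t, h04, hbb0.symm]
  have htg : ∀ i, i ≠ b4 → i ≠ b → i ≠ b0 → t i = {i, ξ i, η i} := fun i h1 h2 h3 => by simp [t, h1, h2, h3]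
  by_cases hall : ∀ S : Finset V, S.card ≤ (S.biUnion t).card
  · obtain ⟨f, hf, hft⟩ := (Finset.all_card_le_biUnion_card_iff_exists_injective t).mp hall
    have hbij : Function.Bijective f := Finite.injective_iff_bijective.mp hf
    let ρ : Equiv.Perm V := Equiv.ofBijective f hbij
    have hρ : ∀ i, ρ i = f i := fun i => rfl
    refine ⟨ρ, fun i => ?_, ?_, ?_, ?_⟩
    · by_cases h1 : i = b4
      · subst h1; left; have := hft i; rw [ht4, Finset.mem_singleton] at this; rw [hρ, this]
      by_cases h2 : i = b
      · subst h2; right; left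
        have := hft i; rw [htb, Finset.mem_singleton] at this; rw [hρ, this, hξb]
      by_cases h3 : i = b0
      · subst h3; right; have := hft i; rw [ht0] at this; simpa [hρ] using this
      have := hft i
      rw [htg i h1 h2 h3] at this
      simpa [hρ] using this
    · have := hft b4; rw [ht4, Finset.mem_singleton] at this; rw [hρ, this]
    · have := hft b; rw [htb, Finset.mem_singleton] at this; rw [hρ, this]
    · have := hft b0
      rw [ht0] at this
      simp only [Finset.mem_insert, Finset.mem_singleton] at this
      rw [hρ]
      rcases this with h | h
      · rw [h]; exact hξ0
      · rw [h]; exact hη0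
  -- a Hall violator contradicts A1 ∧ A2
  exfalso
  push Not at hall
  obtain ⟨S, hS⟩ := hall
  set U := S.biUnion t with hU
  have himg : ∀ i ∈ S, i ≠ b4 → ξ i ∈ U ∧ η i ∈ U := by
    intro i hi hi4
    have hti : t i ⊆ U := by rw [hU]; exact Finset.subset_biUnion_of_mem t hi
    by_cases h2 : i = b
    · subst h2; rw [htb] at hti
      have := hti (Finset.mem_singleton_self _)
      rw [hξb, hηb]; exact ⟨this, this⟩
    by_cases h3 : i = b0
    · subst h3; rw [ht0] at hti; exact ⟨hti (by simp), hti (by simp)⟩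
    rw [htg i hi4 h2 h3] at hti
    exact ⟨hti (by simp), hti (by simp)⟩
  have h4S : b4 ∈ S := by
    by_contra h
    have hsub : S.image ξ ⊆ U := by
      intro v hv
      obtain ⟨i, hi, rfl⟩ := Finset.mem_image.mp hv
      exact (himg i hi (fun e => h (e ▸ hi))).1
    have := Finset.card_le_card hsub
    rw [Finset.card_image_of_injective _ ξ.injective] at this
    omega
  set X := S.erase b4 with hX
  have hXc : X.card = S.card - 1 := Finset.card_erase_of_mem h4S
  have hX4 : b4 ∉ X := Finset.notMem_erase _ _
  have hsubξ : X.image ξ ⊆ U := by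
    intro v hv
    obtain ⟨i, hi, rfl⟩ := Finset.mem_image.mp hv
    rw [Finset.mem_erase] at hi
    exact (himg i hi.2 hi.1).1
  have hsubη : X.image η ⊆ U := by
    intro v hv
    obtain ⟨i, hi, rfl⟩ := Finset.mem_image.mp hv
    rw [Finset.mem_erase] at hi
    exact (himg i hi.2 hi.1).2
  have hUξ : X.image ξ = U := Finset.eq_of_subset_of_card_le hsubξ
    (by rw [Finset.card_image_of_injective _ ξ.injective]; omega)
  have hUη : X.image η = U := Finset.eq_of_subset_of_card_le hsubη
    (by rw [Finset.card_image_of_injective _ η.injective]; omega)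
  have hUcard : U.card = X.card := by rw [← hUξ, Finset.card_image_of_injective _ ξ.injective]
  have h4U : b4 ∈ U := by
    rw [hU, Finset.mem_biUnion]; exact ⟨b4, h4S, by rw [ht4]; simp⟩
  have hgen : ∀ i ∈ X, i ≠ b0 → i ≠ b → i ∈ U := by
    intro i hi hi0 hib
    rw [Finset.mem_erase] at hi
    have hti : t i ⊆ U := by rw [hU]; exact Finset.subset_biUnion_of_mem t hi.2
    rw [htg i hi.1 hib hi0] at hti
    exact hti (by simp)
  have hstepU : ∀ w ∈ X, ξ w ∈ U ∧ η w ∈ U := fun w hw =>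
    ⟨hUξ ▸ Finset.mem_image_of_mem _ hw, hUη ▸ Finset.mem_image_of_mem _ hw⟩
  have hstep1 : ∀ w v, w ∈ X → (v = ξ w ∨ v = η w) → v ∈ U := by
    rintro w v hw (rfl | rfl)
    · exact (hstepU w hw).1
    · exact (hstepU w hw).2
  -- reachability invariants: follow the paths from `b0` and from `z` through `X`
  have R1 : b0 ∈ X → ∀ v, Relation.TransGen r b0 v →
      v ∈ U ∨ ∃ e, e ∈ U ∧ e ∉ X ∧ e ≠ b4 ∧ Relation.ReflTransGen r e v := by
    intro hb0X v h
    induction h with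
    | single h => exact Or.inl (hstep1 b0 _ hb0X ((hr _ _).mp h).1)
    | tail hw hwv ih =>
      rename_i w v'
      obtain ⟨hvw, -, -⟩ := (hr _ _).mp hwv
      rcases ih with hwU | ⟨e, heU, heX, he4, hev⟩
      · by_cases hwX : w ∈ X
        · exact Or.inl (hstep1 w _ hwX hvw)
        · exact Or.inr ⟨w, hwU, hwX, (trans_ne_gates ξ η b0 b4 r hr b0 w hw).2,
            Relation.ReflTransGen.single hwv⟩
      · exact Or.inr ⟨e, heU, heX, he4, hev.tail hwv⟩
  have R2 : b ∈ X → ∀ v, Relation.ReflTransGen r z v →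
      v ∈ U ∨ ∃ e, e ∈ U ∧ e ∉ X ∧ e ≠ b4 ∧ Relation.ReflTransGen r z e := by
    intro hbX v h
    induction h with
    | refl => exact Or.inl (hstep1 b z hbX (Or.inl hξb.symm))
    | tail hw hwv ih =>
      rename_i w v'
      obtain ⟨hvw, -, -⟩ := (hr _ _).mp hwv
      rcases ih with hwU | h
      · by_cases hwX : w ∈ X
        · exact Or.inl (hstep1 w _ hwX hvw)
        · exact Or.inr ⟨w, hwU, hwX, (reach_ne_gates ξ η b0 b4 r hr z w hz0 hz4 hw).2, hw⟩
      · exact Or.inr h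
  obtain ⟨v₂, hzv₂, hv₂⟩ := hA2
  have hv₂4 : v₂ ≠ b4 := (reach_ne_gates ξ η b0 b4 r hr z v₂ hz0 hz4 hzv₂).2
  have hv₂U : v₂ ∈ X → b0 ∈ U := fun h => by
    rcases hv₂ with e | e
    · exact e ▸ (hstepU v₂ h).1
    · exact e ▸ (hstepU v₂ h).2
  -- the case analysis on `b ∈ X`, `b0 ∈ X`
  by_cases hbX : b ∈ X <;> by_cases hb0X : b0 ∈ X
  · -- both in `X`
    by_cases hbU : b ∈ U <;> by_cases hb0U : b0 ∈ U
    · have hsub : insert b4 X ⊆ U := by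
        intro v hv
        rw [Finset.mem_insert] at hv
        rcases hv with rfl | hv
        · exact h4U
        by_cases e0 : v = b0
        · rw [e0]; exact hb0U
        by_cases eb : v = b
        · rw [eb]; exact hbU
        · exact hgen v hv e0 eb
      have := Finset.card_le_card hsub
      rw [Finset.card_insert_of_notMem hX4] at this
      omega
    · have hUeq : U = insert b4 (X.erase b0) := by
        symm
        apply Finset.eq_of_subset_of_card_le
        · intro v hv
          rw [Finset.mem_insert] at hv
          rcases hv with rfl | hv
          · exact h4U
          rw [Finset.mem_erase] at hv
          by_cases eb : v = b
          · rw [eb]; exact hbU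
          · exact hgen v hv.2 hv.1 eb
        · rw [Finset.card_insert_of_notMem (by simp [hX4]), Finset.card_erase_of_mem hb0X]; omega
      rcases R2 hbX v₂ hzv₂ with h | ⟨e, heU, heX, he4, -⟩
      · rw [hUeq, Finset.mem_insert, Finset.mem_erase] at h
        rcases h with h | h
        · exact hv₂4 h
        · exact hb0U (hv₂U h.2)
      · rw [hUeq, Finset.mem_insert, Finset.mem_erase] at heU
        rcases heU with h | h
        · exact he4 h
        · exact heX h.2
    · have hUeq : U = insert b4 (X.erase b) := by
        symm
        apply Finset.eq_of_subset_of_card_le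
        · intro v hv
          rw [Finset.mem_insert] at hv
          rcases hv with rfl | hv
          · exact h4U
          rw [Finset.mem_erase] at hv
          by_cases e0 : v = b0
          · rw [e0]; exact hb0U
          · exact hgen v hv.2 e0 hv.1
        · rw [Finset.card_insert_of_notMem (by simp [hX4]), Finset.card_erase_of_mem hbX]; omega
      rcases R1 hb0X b hA1 with h | ⟨e, heU, heX, he4, -⟩
      · exact hbU h
      · rw [hUeq, Finset.mem_insert, Finset.mem_erase] at heU
        rcases heU with h | h
        · exact he4 h
        · exact heX h.2
    · -- neither `b` nor `b0` is in `U`: one escape point, reached from `z` and reaching `b`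
      obtain ⟨e₁, he₁U, he₁X, he₁4, he₁b⟩ : ∃ e, e ∈ U ∧ e ∉ X ∧ e ≠ b4 ∧ Relation.ReflTransGen r e b := by
        rcases R1 hb0X b hA1 with h | h
        · exact absurd h hbU
        · exact h
      obtain ⟨e₂, he₂U, he₂X, he₂4, hze₂⟩ : ∃ e, e ∈ U ∧ e ∉ X ∧ e ≠ b4 ∧ Relation.ReflTransGen r z e := by
        rcases R2 hbX v₂ hzv₂ with h | h
        · refine ⟨v₂, h, fun hx => hb0U (hv₂U hx), hv₂4, hzv₂⟩
        · exact h
      have he : e₁ = e₂ := by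
        by_contra hne
        set U0 := insert b4 ((X.erase b0).erase b) with hU0
        have hsub : insert e₁ (insert e₂ U0) ⊆ U := by
          intro v hv
          simp only [Finset.mem_insert, hU0, Finset.mem_erase] at hv
          rcases hv with rfl | rfl | rfl | ⟨hvb, hv0, hvX⟩
          · exact he₁U
          · exact he₂U
          · exact h4U
          · exact hgen v hvX hv0 hvb
        have hc := Finset.card_le_card hsub
        have h1 : e₁ ∉ insert e₂ U0 := by simp [hU0, hne, he₁4, he₁X]
        have h2 : e₂ ∉ U0 := by simp [hU0, he₂4, he₂X]
        rw [Finset.card_insert_of_notMem h1, Finset.card_insert_of_notMem h2, hU0,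
          Finset.card_insert_of_notMem (by simp [hX4]),
          Finset.card_erase_of_mem (by simp [hbb0, hbX]), Finset.card_erase_of_mem hb0X] at hc
        have : 2 ≤ X.card := by
          have := Finset.card_le_card (show ({b0, b} : Finset V) ⊆ X by
            intro v hv; simp only [Finset.mem_insert, Finset.mem_singleton] at hv
            rcases hv with rfl | rfl; exacts [hb0X, hbX])
          rwa [Finset.card_pair hbb0.symm] at this
        omega
      subst he
      exact hzD (reach_mem_of_predClosed ξ η b0 b4 r hr D hD z b hz0 hz4 (hze₂.trans he₁b) hbD)
  · -- `b ∈ X`, `b0 ∉ X`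
    have hUeq : U = insert b4 (X.erase b) := by
      symm
      apply Finset.eq_of_subset_of_card_le
      · intro v hv
        rw [Finset.mem_insert] at hv
        rcases hv with rfl | hv
        · exact h4U
        rw [Finset.mem_erase] at hv
        exact hgen v hv.2 (fun e => hb0X (e ▸ hv.2)) hv.1
      · rw [Finset.card_insert_of_notMem (by simp [hX4]), Finset.card_erase_of_mem hbX]; omega
    rcases R2 hbX v₂ hzv₂ with h | ⟨e, heU, heX, he4, -⟩
    · rw [hUeq, Finset.mem_insert, Finset.mem_erase] at h
      rcases h with h | h
      · exact hv₂4 h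
      · have := hv₂U h.2
        rw [hUeq, Finset.mem_insert, Finset.mem_erase] at this
        rcases this with h' | h'
        · exact h04 h'
        · exact hb0X h'.2
    · rw [hUeq, Finset.mem_insert, Finset.mem_erase] at heU
      rcases heU with h | h
      · exact he4 h
      · exact heX h.2
  · -- `b ∉ X`, `b0 ∈ X`
    have hUeq : U = insert b4 (X.erase b0) := by
      symm
      apply Finset.eq_of_subset_of_card_le
      · intro v hv
        rw [Finset.mem_insert] at hv
        rcases hv with rfl | hv
        · exact h4U
        rw [Finset.mem_erase] at hv
        exact hgen v hv.2 hv.1 (fun e => hbX (e ▸ hv.2))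
      · rw [Finset.card_insert_of_notMem (by simp [hX4]), Finset.card_erase_of_mem hb0X]; omega
    rcases R1 hb0X b hA1 with h | ⟨e, heU, heX, he4, -⟩
    · rw [hUeq, Finset.mem_insert, Finset.mem_erase] at h
      rcases h with h | h
      · exact hbb4 h
      · exact hbX h.2
    · rw [hUeq, Finset.mem_insert, Finset.mem_erase] at heU
      rcases heU with h | h
      · exact he4 h
      · exact heX h.2
  · -- neither: too few loops
    have hsub : insert b4 X ⊆ U := by
      intro v hv
      rw [Finset.mem_insert] at hv
      rcases hv with rfl | hv
      · exact h4U
      · exact hgen v hv (fun e => hb0X (e ▸ hv)) (fun e => hbX (e ▸ hv))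
    have := Finset.card_le_card hsub
    rw [Finset.card_insert_of_notMem hX4] at this
    omega

end QCover
end Core
end MarkedEdge
end Summit.ValiantsHypothesis.ValiantsHypothesis.Theorems.KPlusLogSqLaw
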